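import Mathlib.NumberTheory.DirichletCharacter.Orthogonality
import Mathlib.LinearAlgebra.Dual.Lemmas
import Mathlib.Analysis.Complex.Polynomial.Basic
import Mathlib.RingTheory.RootsOfUnity.AlgebraicallyClosed
import Mathlib.Algebra.BigOperators.Field
import Literature.NumberTheory.Transcendental.GammaMonomialsLValue
import HarnessLib

/-!
# Odd distributions on `ℤ/N` and the Bernoulli distribution (Kubert–Lang), for Koblitz–Ogus

Support file II (everything PROVED; no named facts, no definitions, no notation, no `sorry`) for the
discharge of `Literature.NumberTheory.Transcendental.deligne_gammaMonomial_algebraic`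
(algebraicity of Γ-monomials of Hodge type: Deligne, LNM 900, Thm. 7.15 (a)/7.18 (a); elementary
proof by Koblitz–Ogus, appendix to Deligne, PSPM 33.2 (1979) 343–346, "by taking the correct
combinations of multiplication and reflection formulae", using the ideas of Kubert and Lang on
distributions). This file is the linear-algebra heart of that proof, on `ℤ/N` (`N ≥ 1`):

* The **Bernoulli distribution** `β(x) = x.val/N - 1/2` (`x ≠ 0`), `β(0) = 0`, is odd (`bern_neg`)
  and satisfies the distribution relations `∑_{x ≡ y (mod M)} β(x) = β((N/M)·y)` for every `M ∣ N`
  (`bern_dist`), as do its unit twists `x ↦ β(ux)` (`bern_unit_dist`).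
* **Injectivity** (`oddDist_eq_zero`): an odd function `g : ℤ/N → ℂ` satisfying all distribution
  relations and whose "primitive odd coordinates" `Φ_χ[g] = ∑_x χ₀(x mod f_χ) g(x)` vanish for all
  odd Dirichlet characters `χ` mod `N` (`χ₀` the primitive character inducing `χ`, `f_χ` its
  conductor) is zero. (Strong induction on the level; Fourier inversion on `(ℤ/M)ˣ`
  (`eq_zero_of_forall_sum_char`); even characters by oddness; odd characters by lowering the level
  to the conductor (`sum_eq_sum_level`) — this is where Mathlib's conductor theory
  `conductor_changeLevel` / `primitiveCharacter_changeLevel_apply` enters.)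
* **Spanning** (`oddDist_eq_sum_bern`): every odd distribution is `∑_u c(u) β(u·)` with `c`
  supported on units; the coefficients come from character orthogonality, and the one arithmetic
  input is `Φ_χ[β] = B_{1,χ₀} = (1/f) ∑ χ₀(v) v ≠ 0` (`prim_sum_bern`, `prim_sum_bern_ne_zero`, from
  `GammaMonomialsLValue.sum_char_mul_val_ne_zero`, i.e. `L(0, χ₀) ≠ 0`).
* **Hodge type ⟹ relation** (`hodge_eq_combination`, `hodge_eq_combination_int`): if
  `f : ℤ/N → ℚ` (resp. `ℤ`) satisfies `∑_x f(x) β(ux) = 0` for all units `u`, then `f` (resp. a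
  positive multiple `n₀ f`) is a rational (resp. integral) combination of the REFLECTION vectors
  `e_a + e_{-a}` and the DISTRIBUTION vectors `∑_{x ≡ y (M)} e_x - e_{(N/M)y}`, `M ∣ N` — by the
  double annihilator (`Subspace.dualAnnihilator_dualCoannihilator_eq`): a functional killing these
  vectors is an odd distribution, hence a combination of the `β(u·)`, which kill `f`.

The file `GammaMonomialsProofs.lean` turns such a relation into the algebraicity statement via
the reflection and Gauss multiplication formulas for `Γ`.

References: S. Lang, *Cyclotomic Fields I and II*, GTM 121, Ch. 2 (§2 Bernoulli/Stickelberger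
distributions, §8–§10 the universal distribution, Kubert's theorem); D. Kubert, Bull. SMF 107
(1979); Koblitz–Ogus, loc. cit.; Deligne, LNM 900, Rem. 7.16 (a).
-/

noncomputable section

open Finset

namespace Literature.NumberTheory.Transcendental

namespace KoblitzOgus

variable {N : ℕ} [NeZero N]

/-! ### Fibres of reduction mod `M` -/

/-- For `M ∣ N` (`N ≠ 0`), the quotient `N / M` is nonzero and `N = M · (N/M)`. [folklore] -/
theorem div_ne_zero_of_dvd {M : ℕ} (hM : M ∣ N) : M ≠ 0 ∧ N / M ≠ 0 ∧ N = M * (N / M) := by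
  have hN : N ≠ 0 := NeZero.ne N
  have hM0 : M ≠ 0 := by rintro rfl; exact hN (zero_dvd_iff.mp hM)
  refine ⟨hM0, ?_, (Nat.mul_div_cancel' hM).symm⟩
  exact (Nat.div_ne_zero_iff_of_dvd hM).mpr ⟨hN, hM0⟩

/-- The elements `r + jM`, `j < N/M`, `r = y mod M`, are `< N`. [folklore] -/
theorem mod_add_mul_lt {M : ℕ} (hM : M ∣ N) (y : ZMod N) {j : ℕ} (hj : j < N / M) :
    y.val % M + j * M < N := by
  obtain ⟨hM0, -, hNM⟩ := div_ne_zero_of_dvd hM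
  have hr : y.val % M < M := Nat.mod_lt _ (Nat.pos_of_ne_zero hM0)
  calc y.val % M + j * M < M + j * M := by omega
    _ = (j + 1) * M := by ring
    _ ≤ (N / M) * M := Nat.mul_le_mul_right _ hj
    _ = N := by rw [mul_comm]; exact hNM.symm

/-- **Fibre enumeration.** For `M ∣ N` and `y ∈ ℤ/N`, the `x ∈ ℤ/N` with `x ≡ y (mod M)` are
exactly the residues of `r + jM`, `0 ≤ j < N/M`, where `r = y mod M`; hence a sum over the fibre
is a sum over `j`. [folklore] -/
theorem sum_fiber_eq_sum_range {K : Type*} [AddCommMonoid K] {M : ℕ} (hM : M ∣ N) (y : ZMod N)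
    (F : ZMod N → K) :
    ∑ x ∈ univ.filter (fun x : ZMod N => x.val % M = y.val % M), F x =
      ∑ j ∈ range (N / M), F ((y.val % M + j * M : ℕ) : ZMod N) := by
  classical
  obtain ⟨hM0, hm0, hNM⟩ := div_ne_zero_of_dvd hM
  have hMpos : 0 < M := Nat.pos_of_ne_zero hM0
  set r := y.val % M with hr
  have hval : ∀ j ∈ range (N / M), ((r + j * M : ℕ) : ZMod N).val = r + j * M := fun j hj =>
    ZMod.val_natCast_of_lt (mod_add_mul_lt hM y (mem_range.mp hj))
  have hinj : Set.InjOn (fun j : ℕ => ((r + j * M : ℕ) : ZMod N)) (range (N / M) : Finset ℕ) := by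
    intro j₁ hj₁ j₂ hj₂ h
    have := congrArg ZMod.val h
    simp only at this
    rw [hval j₁ hj₁, hval j₂ hj₂] at this
    have : j₁ * M = j₂ * M := by omega
    exact Nat.eq_of_mul_eq_mul_right hMpos this
  rw [← sum_image hinj]
  apply sum_congr _ fun _ _ => rfl
  ext x
  simp only [mem_filter, mem_univ, true_and, mem_image, mem_range]
  constructor
  · intro hx
    refine ⟨x.val / M, ?_, ?_⟩
    · exact Nat.div_lt_of_lt_mul (by rw [← hNM]; exact ZMod.val_lt x)
    · rw [← hx, Nat.mod_add_div' x.val M, ZMod.natCast_zmod_val]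
  · rintro ⟨j, hj, rfl⟩
    rw [hval j (mem_range.mpr hj), Nat.add_mul_mod_self_right, Nat.mod_eq_of_lt (Nat.mod_lt _ hMpos)]

/-- The value of `(N/M) · y` in `ℤ/N`: `((N/M) y).val = (N/M) (y mod M)`. [folklore] -/
theorem val_div_mul {M : ℕ} (hM : M ∣ N) (y : ZMod N) :
    (((N / M : ℕ) : ZMod N) * y).val = (N / M) * (y.val % M) := by
  obtain ⟨hM0, hm0, hNM⟩ := div_ne_zero_of_dvd hM
  have hlt : (N / M) * (y.val % M) < N := by
    calc (N / M) * (y.val % M) < (N / M) * M :=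
          Nat.mul_lt_mul_of_pos_left (Nat.mod_lt _ (Nat.pos_of_ne_zero hM0)) (Nat.pos_of_ne_zero hm0)
      _ = N := Nat.div_mul_cancel hM
  have hcast : ((N / M : ℕ) : ZMod N) * y = (((N / M) * y.val : ℕ) : ZMod N) := by
    rw [Nat.cast_mul, ZMod.natCast_zmod_val]
  have harith : (N / M) * y.val = (N / M) * (y.val % M) + N * (y.val / M) := by
    conv_lhs => rw [← Nat.mod_add_div y.val M]
    rw [mul_add, ← mul_assoc, Nat.div_mul_cancel hM]
  rw [hcast, ZMod.val_natCast, harith, Nat.add_mul_mod_self_left, Nat.mod_eq_of_lt hlt]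


-- This file introduces no definitions and no notation. Recurring expressions, always written out:
-- * the Bernoulli distribution `β_K(x) = (if x = 0 then 0 else x.val/N - 1/2 : K)` on `ℤ/N`;
-- * the fibre `{x : x.val % M = y.val % M}` of reduction mod `M` through `y` (a `Finset.filter`);
-- * the element `(N/M)·v := ((N/M : ℕ) : ZMod N) * (v.val : ZMod N)` for `v : ZMod M`;
-- * the primitive coordinate weight `χ₀(x mod f_χ) := χ.primitiveCharacter (ZMod.castHom _ _ x)`.

/-! ### The Bernoulli distribution `β(x) = ⟨x/N⟩ - 1/2` (`β(0) = 0`) -/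

/-- `β` is odd: `β(-x) = -β(x)`. [folklore] -/
theorem bern_neg {K : Type*} [Field K] [CharZero K] (x : ZMod N) : (if (-x) = (0 : ZMod N) then (0 : K) else (((ZMod.val (-x) : ℕ) : K) / (N : K) - 1 / 2)) = -(if x = (0 : ZMod N) then (0 : K) else (((ZMod.val x : ℕ) : K) / (N : K) - 1 / 2)) := by
  by_cases hx : x = 0
  · simp [hx]
  · have hx' : -x ≠ 0 := neg_ne_zero.mpr hx
    rw [if_neg hx', if_neg hx, ZMod.neg_val, if_neg hx, Nat.cast_sub (ZMod.val_lt x).le]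
    have hN : (N : K) ≠ 0 := by exact_mod_cast NeZero.ne N
    field_simp
    ring

/-- `∑_{j < m} [r + jM = 0] c = [r = 0] c` for `m, M ≥ 1`. [folklore] -/
theorem sum_range_ite_add_mul_eq_zero {K : Type*} [AddCommMonoid K] {M m : ℕ} (hM : M ≠ 0)
    (hm : m ≠ 0) (r : ℕ) (c : K) :
    ∑ j ∈ range m, (if r + j * M = 0 then c else 0) = if r = 0 then c else 0 := by
  by_cases hr : r = 0
  · subst hr
    rw [if_pos rfl]
    have : ∀ j ∈ range m, (if 0 + j * M = 0 then c else 0) = if j = 0 then c else 0 := by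
      intro j _
      congr 1
      simp [hM]
    rw [sum_congr rfl this, sum_ite_eq']
    simp [Nat.pos_of_ne_zero hm]
  · rw [if_neg hr]
    exact sum_eq_zero fun j _ => if_neg (by omega)

/-- **`β` is a distribution**: for `M ∣ N` and `y ∈ ℤ/N`,
`∑_{x ≡ y (mod M)} β(x) = β((N/M)·y)` (the multiplication / distribution relation of the first
Bernoulli polynomial, `∑_{j<m} B₁((x+j)/m) = B₁(x)`, in the normalisation `β(0) = 0`).
[cite: Lang1990, Ch. 2 §2] -/
theorem bern_dist {K : Type*} [Field K] [CharZero K] {M : ℕ} (hM : M ∣ N) (y : ZMod N) :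
    ∑ x ∈ (Finset.univ.filter (fun x' : ZMod N => ZMod.val x' % M = ZMod.val y % M)), (if x = (0 : ZMod N) then (0 : K) else (((ZMod.val x : ℕ) : K) / (N : K) - 1 / 2)) = (if (((N / M : ℕ) : ZMod N) * y) = (0 : ZMod N) then (0 : K) else (((ZMod.val (((N / M : ℕ) : ZMod N) * y) : ℕ) : K) / (N : K) - 1 / 2)) := by
  obtain ⟨hM0, hm0, hNM⟩ := div_ne_zero_of_dvd hM
  have hN : (N : K) ≠ 0 := by exact_mod_cast NeZero.ne N
  have hMK : (M : K) ≠ 0 := by exact_mod_cast hM0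
  set m := N / M with hmdef
  set r := y.val % M with hrdef
  have hNMK : (N : K) = M * m := by exact_mod_cast hNM
  rw [sum_fiber_eq_sum_range hM y]
  -- pointwise description of the summands
  have hpt : ∀ j ∈ range m, (if (((r + j * M : ℕ) : ZMod N)) = (0 : ZMod N) then (0 : K) else (((ZMod.val (((r + j * M : ℕ) : ZMod N)) : ℕ) : K) / (N : K) - 1 / 2)) =
      (((r + j * M : ℕ) : K) / N - 1 / 2) + (if r + j * M = 0 then 1 / 2 else 0) := by
    intro j hj
    have hv : ((r + j * M : ℕ) : ZMod N).val = r + j * M :=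
      ZMod.val_natCast_of_lt (mod_add_mul_lt hM y (mem_range.mp hj))
    by_cases h0 : r + j * M = 0
    · rw [if_pos h0, h0, Nat.cast_zero, if_pos rfl]
      simp
    · have hne : ((r + j * M : ℕ) : ZMod N) ≠ 0 := by
        intro h
        rw [← ZMod.val_eq_zero, hv] at h
        exact h0 h
      rw [if_neg hne, if_neg h0, hv, add_zero]
  rw [sum_congr rfl hpt, sum_add_distrib, sum_range_ite_add_mul_eq_zero hM0 hm0, sum_sub_distrib,
    sum_const, card_range, ← Finset.sum_div]
  -- the arithmetic progression sum
  have hgauss : (∑ j ∈ range m, ((r + j * M : ℕ) : K)) = m * r + M * (m * (m - 1) / 2) := by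
    have h2 := Finset.sum_range_id_mul_two m
    have h1m : 1 ≤ m := Nat.pos_of_ne_zero hm0
    have h2K : (∑ j ∈ range m, (j : K)) * 2 = m * (m - 1 : K) := by
      have := congrArg (Nat.cast (R := K)) h2
      push_cast [Nat.cast_sub h1m] at this
      exact this
    push_cast
    rw [sum_add_distrib, sum_const, card_range, ← sum_mul]
    simp only [nsmul_eq_mul]
    linear_combination (M : K) / 2 * h2K
  rw [hgauss]
  -- the right-hand side
  have hval : (((N / M : ℕ) : ZMod N) * y).val = m * r := val_div_mul hM y
  by_cases hr0 : r = 0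
  · have hzero : ((N / M : ℕ) : ZMod N) * y = 0 := by
      rw [← ZMod.val_eq_zero, hval, hr0, mul_zero]
    rw [if_pos hr0, if_pos hzero, hr0]
    simp only [Nat.cast_zero, mul_zero, zero_add, nsmul_eq_mul]
    rw [hNMK]
    field_simp
    ring
  · have hne : ((N / M : ℕ) : ZMod N) * y ≠ 0 := by
      rw [Ne, ← ZMod.val_eq_zero, hval]
      exact Nat.mul_ne_zero hm0 hr0
    rw [if_neg hr0, if_neg hne, hval]
    simp only [add_zero, nsmul_eq_mul]
    push_cast
    rw [hNMK]
    field_simp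
    ring


/-! ### Reduction mod `M`; twisting fibres by units -/

/-- `x ≡ y (mod M)` iff the reductions mod `M` agree. [folklore] -/
theorem mod_eq_mod_iff_castHom {M : ℕ} (hM : M ∣ N) (x y : ZMod N) :
    x.val % M = y.val % M ↔ ZMod.castHom hM (ZMod M) x = ZMod.castHom hM (ZMod M) y := by
  rw [ZMod.castHom_apply, ZMod.castHom_apply, ZMod.cast_eq_val, ZMod.cast_eq_val,
    ZMod.natCast_eq_natCast_iff']

/-- Multiplication by a unit permutes the fibres: `x ≡ y (M) ↔ ux ≡ uy (M)`. [folklore] -/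
theorem unit_mul_mem_fib_iff {M : ℕ} (hM : M ∣ N) {u : ZMod N} (hu : IsUnit u) (x y : ZMod N) :
    x.val % M = y.val % M ↔ (u * x).val % M = (u * y).val % M := by
  rw [mod_eq_mod_iff_castHom hM, mod_eq_mod_iff_castHom hM, map_mul, map_mul]
  exact ⟨fun h => by rw [h], fun h => (hu.map (ZMod.castHom hM (ZMod M))).mul_left_cancel h⟩

/-- Reindexing a fibre sum by a unit: `∑_{x ≡ y (M)} F(ux) = ∑_{x ≡ uy (M)} F(x)`. [folklore] -/
theorem sum_fib_unit_mul {K : Type*} [AddCommMonoid K] {M : ℕ} (hM : M ∣ N) {u : ZMod N}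
    (hu : IsUnit u) (y : ZMod N) (F : ZMod N → K) :
    ∑ x ∈ (Finset.univ.filter (fun x' : ZMod N => ZMod.val x' % M = ZMod.val y % M)), F (u * x) = ∑ x ∈ (Finset.univ.filter (fun x' : ZMod N => ZMod.val x' % M = ZMod.val (u * y) % M)), F x := by
  refine Finset.sum_equiv hu.unit.mulLeft (fun x => ?_) (fun x _ => ?_)
  · simp only [mem_filter, mem_univ, true_and, Units.mulLeft_apply, IsUnit.unit_spec]
    exact unit_mul_mem_fib_iff hM hu x y
  · simp [Units.mulLeft_apply]

/-- The unit twists `x ↦ β(ux)` of the Bernoulli distribution are again distributions.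
[cite: Lang1990, Ch. 2 §2] -/
theorem bern_unit_dist {K : Type*} [Field K] [CharZero K] {M : ℕ} (hM : M ∣ N) {u : ZMod N}
    (hu : IsUnit u) (y : ZMod N) :
    ∑ x ∈ (Finset.univ.filter (fun x' : ZMod N => ZMod.val x' % M = ZMod.val y % M)), (if (u * x) = (0 : ZMod N) then (0 : K) else (((ZMod.val (u * x) : ℕ) : K) / (N : K) - 1 / 2)) = (if (u * (((N / M : ℕ) : ZMod N) * y)) = (0 : ZMod N) then (0 : K) else (((ZMod.val (u * (((N / M : ℕ) : ZMod N) * y)) : ℕ) : K) / (N : K) - 1 / 2)) := by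
  have h := sum_fib_unit_mul hM hu y (fun x => (if x = (0 : ZMod N) then (0 : K) else (((ZMod.val x : ℕ) : K) / (N : K) - 1 / 2)))
  rw [h, bern_dist hM (u * y), mul_left_comm]

/-! ### Lowering the level of a distribution sum -/

/-- **Level lowering.** If `g` satisfies the distribution relations of level `M ∣ N`, then for any
`η` on `ℤ/M`: `∑_{x mod N} η(x mod M) g(x) = ∑_{v mod M} η(v) g((N/M)·v)`. [folklore] -/
theorem sum_eq_sum_level {K : Type*} [CommRing K] {M : ℕ} [NeZero M] (hM : M ∣ N)
    (g : ZMod N → K)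
    (hdist : ∀ y : ZMod N, ∑ x ∈ (Finset.univ.filter (fun x' : ZMod N => ZMod.val x' % M = ZMod.val y % M)), g x = g (((N / M : ℕ) : ZMod N) * y))
    (η : ZMod M → K) :
    ∑ x : ZMod N, η (ZMod.castHom hM (ZMod M) x) * g x = ∑ v : ZMod M, η v * g ((((N / M : ℕ) : ZMod N) * ((ZMod.val v : ℕ) : ZMod N))) := by
  classical
  rw [← Finset.sum_fiberwise univ (ZMod.castHom hM (ZMod M))
    (fun x => η (ZMod.castHom hM (ZMod M) x) * g x)]
  refine sum_congr rfl fun v _ => ?_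
  have hfib : (univ.filter fun x : ZMod N => ZMod.castHom hM (ZMod M) x = v) =
      (Finset.univ.filter (fun x' : ZMod N => ZMod.val x' % M = ZMod.val (((v.val : ℕ) : ZMod N)) % M)) := by
    ext x
    simp only [mem_filter, mem_univ, true_and]
    rw [mod_eq_mod_iff_castHom hM, map_natCast, ZMod.natCast_zmod_val]
  calc ∑ x ∈ univ.filter (fun x => ZMod.castHom hM (ZMod M) x = v),
        η (ZMod.castHom hM (ZMod M) x) * g x
      = ∑ x ∈ univ.filter (fun x => ZMod.castHom hM (ZMod M) x = v), η v * g x :=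
        sum_congr rfl fun x hx => by rw [(mem_filter.mp hx).2]
    _ = η v * ∑ x ∈ (Finset.univ.filter (fun x' : ZMod N => ZMod.val x' % M = ZMod.val (((v.val : ℕ) : ZMod N)) % M)), g x := by rw [← mul_sum, hfib]
    _ = _ := by rw [hdist]

/-! ### The elements `(N/M)·v` -/

/-- `(N/M)·(-v) = -(N/M)·v` in `ℤ/N`. [folklore] -/
theorem lift_neg {M : ℕ} (hM : M ∣ N) (v : ZMod M) : (((N / M : ℕ) : ZMod N) * ((ZMod.val (-v) : ℕ) : ZMod N)) = -(((N / M : ℕ) : ZMod N) * ((ZMod.val v : ℕ) : ZMod N)) := by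
  obtain ⟨hM0, -, -⟩ := div_ne_zero_of_dvd hM
  haveI : NeZero M := ⟨hM0⟩
  by_cases hv : v = 0
  · simp [hv]
  · rw [ZMod.neg_val, if_neg hv, Nat.cast_sub (ZMod.val_lt v).le, mul_sub]
    have : ((N / M : ℕ) : ZMod N) * (M : ZMod N) = 0 := by
      rw [← Nat.cast_mul, Nat.div_mul_cancel hM, ZMod.natCast_self]
    rw [this, zero_sub]

/-- At the top level, `(N/N)·x = x`. [folklore] -/
theorem lift_self (x : ZMod N) : (((N / N : ℕ) : ZMod N) * ((ZMod.val x : ℕ) : ZMod N)) = x := by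
  rw [Nat.div_self (NeZero.pos N), Nat.cast_one, one_mul, ZMod.natCast_zmod_val]

/-- **Reduction to a unit of smaller level.** For `M ∣ N` and `v ∈ ℤ/M`, with `g = gcd(M, v)` and
`M' = M/g`: `M' ∣ M`, and `(N/M)·v = (N/M')·w` for the UNIT `w = v/g ∈ ℤ/M'`; moreover `M' < M`
unless `v` is a unit. [folklore] -/
theorem lift_reduce {M : ℕ} (hM : M ∣ N) (v : ZMod M) :
    (M / M.gcd v.val) ∣ M ∧
    (∃ w : ZMod (M / M.gcd v.val), IsUnit w ∧ (((N / (M / M.gcd v.val) : ℕ) : ZMod N) * ((ZMod.val w : ℕ) : ZMod N)) = (((N / M : ℕ) : ZMod N) * ((ZMod.val v : ℕ) : ZMod N))) ∧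
    (¬IsUnit v → M / M.gcd v.val < M) := by
  obtain ⟨hM0, hm0, hNM⟩ := div_ne_zero_of_dvd hM
  haveI : NeZero M := ⟨hM0⟩
  have hMpos : 0 < M := Nat.pos_of_ne_zero hM0
  set g := M.gcd v.val with hgdef
  have hg : 0 < g := Nat.gcd_pos_of_pos_left _ hMpos
  have hgM : g ∣ M := Nat.gcd_dvd_left _ _
  have hgv : g ∣ v.val := Nat.gcd_dvd_right _ _
  set M' := M / g with hM'def
  have hM'M : M' ∣ M := Nat.div_dvd_of_dvd hgM
  have hM'pos : 0 < M' := Nat.div_pos (Nat.le_of_dvd hMpos hgM) hg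
  refine ⟨hM'M, ⟨((v.val / g : ℕ) : ZMod M'), ?_, ?_⟩, ?_⟩
  · rw [ZMod.isUnit_iff_coprime]
    exact (Nat.coprime_div_gcd_div_gcd hg).symm
  · have hwval : (((v.val / g : ℕ) : ZMod M')).val = v.val / g :=
      ZMod.val_natCast_of_lt (Nat.div_lt_div_of_lt_of_dvd hgM (ZMod.val_lt v))
    have hNM' : N / M' = N / M * g := by
      refine Nat.div_eq_of_eq_mul_left hM'pos ?_
      calc N = N / M * M := (Nat.div_mul_cancel hM).symm
        _ = N / M * (g * M') := by rw [Nat.mul_div_cancel' hgM]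
        _ = N / M * g * M' := by ring
    rw [hwval, hNM', ← Nat.cast_mul, ← Nat.cast_mul, mul_assoc, Nat.mul_div_cancel' hgv]
  · intro hv
    refine Nat.div_lt_self hMpos (lt_of_le_of_ne hg fun h1 => hv ?_)
    rw [← ZMod.natCast_zmod_val v, ZMod.isUnit_iff_coprime]
    exact Nat.Coprime.symm (Nat.coprime_iff_gcd_eq_one.mpr h1.symm)

/-! ### Fourier inversion on `(ℤ/M)ˣ` and the injectivity theorem -/

/-- **Fourier inversion on `(ℤ/M)ˣ`**: if `∑_v ψ(v) G(v) = 0` for every Dirichlet character `ψ`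
mod `M`, then `G` vanishes at all units. [folklore] -/
theorem eq_zero_of_forall_sum_char {M : ℕ} [NeZero M] (G : ZMod M → ℂ)
    (h : ∀ ψ : DirichletCharacter ℂ M, ∑ v : ZMod M, ψ v * G v = 0) {w : ZMod M}
    (hw : IsUnit w) : G w = 0 := by
  classical
  have key : ∑ ψ : DirichletCharacter ℂ M, ψ w⁻¹ * (∑ v : ZMod M, ψ v * G v) =
      (M.totient : ℂ) * G w := by
    calc ∑ ψ : DirichletCharacter ℂ M, ψ w⁻¹ * (∑ v : ZMod M, ψ v * G v)
        = ∑ v : ZMod M, (∑ ψ : DirichletCharacter ℂ M, ψ w⁻¹ * ψ v) * G v := by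
          simp_rw [Finset.mul_sum]
          rw [Finset.sum_comm]
          simp_rw [← mul_assoc, ← Finset.sum_mul]
      _ = ∑ v : ZMod M, (if w = v then (M.totient : ℂ) else 0) * G v := by
          refine sum_congr rfl fun v _ => ?_
          rw [DirichletCharacter.sum_char_inv_mul_char_eq ℂ hw v]
      _ = (M.totient : ℂ) * G w := by
          simp only [ite_mul, zero_mul, Finset.sum_ite_eq, Finset.mem_univ, if_true]
  have h0 : ∑ ψ : DirichletCharacter ℂ M, ψ w⁻¹ * (∑ v : ZMod M, ψ v * G v) = 0 :=
    sum_eq_zero fun ψ _ => by rw [h ψ, mul_zero]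
  rw [h0] at key
  have hφ : (M.totient : ℂ) ≠ 0 := by exact_mod_cast (Nat.totient_pos.mpr (NeZero.pos M)).ne'
  exact (mul_eq_zero.mp key.symm).resolve_left hφ

omit [NeZero N] in
/-- A level change preserves oddness. [folklore] -/
theorem odd_changeLevel {M : ℕ} (hM : M ∣ N) {ψ : DirichletCharacter ℂ M} (hψ : ψ.Odd) :
    (DirichletCharacter.changeLevel hM ψ).Odd := by
  rw [DirichletCharacter.Odd]
  have := DirichletCharacter.changeLevel_eq_cast_of_dvd ψ hM (-1)
  rw [Units.val_neg, Units.val_one] at this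
  rw [this, ← ZMod.castHom_apply (h := hM), map_neg, map_one]
  exact hψ

/-- **Injectivity (Kubert–Lang): an odd distribution with vanishing primitive odd coordinates is
zero.** Let `g : ℤ/N → ℂ` be odd and satisfy the distribution relations for all `M ∣ N`. If
`∑_x χ₀(x) g(x) = 0` for every odd character `χ` mod `N` (`χ₀` its primitive character, evaluated
at `x mod f_χ`), then `g = 0`. Proof: strong induction on the level `M` of `x = (N/M)·w`, `w` a unit
mod `M`; Fourier inversion on `(ℤ/M)ˣ`; even `ψ` by oddness of `g`; odd `ψ` by the induction
hypothesis (non-units have smaller level) and level lowering to the primitive coordinate.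
[cite: Lang1990, Ch. 2 §8–§10] -/
theorem oddDist_eq_zero (g : ZMod N → ℂ) (hodd : ∀ x, g (-x) = -g x)
    (hdist : ∀ M : ℕ, ∀ hM : M ∣ N, ∀ y : ZMod N,
      ∑ x ∈ (Finset.univ.filter (fun x' : ZMod N => ZMod.val x' % M = ZMod.val y % M)), g x = g (((N / M : ℕ) : ZMod N) * y))
    (hΦ : ∀ χ : DirichletCharacter ℂ N, χ.Odd →
      ∑ x : ZMod N, ((DirichletCharacter.primitiveCharacter χ) (ZMod.castHom (DirichletCharacter.conductor_dvd_level χ) (ZMod (DirichletCharacter.conductor χ)) x)) * g x = 0)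
    (x : ZMod N) : g x = 0 := by
  classical
  have h0 : g 0 = 0 := by
    have := hodd 0
    rw [neg_zero] at this
    exact self_eq_neg.mp this
  have main : ∀ M : ℕ, M ∣ N → ∀ w : ZMod M, IsUnit w → g ((((N / M : ℕ) : ZMod N) * ((ZMod.val w : ℕ) : ZMod N))) = 0 := by
    intro M
    induction M using Nat.strong_induction_on with
    | _ M IH =>
    intro hM w hw
    obtain ⟨hM0, hm0, hNM⟩ := div_ne_zero_of_dvd hM
    haveI : NeZero M := ⟨hM0⟩
    refine eq_zero_of_forall_sum_char (fun v => g ((((N / M : ℕ) : ZMod N) * ((ZMod.val v : ℕ) : ZMod N)))) (fun ψ => ?_) hw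
    rcases ψ.even_or_odd with hψ | hψ
    · -- even characters: the sum equals its own negative
      have hT : ∑ v : ZMod M, ψ v * g ((((N / M : ℕ) : ZMod N) * ((ZMod.val v : ℕ) : ZMod N))) = -∑ v : ZMod M, ψ v * g ((((N / M : ℕ) : ZMod N) * ((ZMod.val v : ℕ) : ZMod N))) := by
        conv_lhs => rw [← Equiv.sum_comp (Equiv.neg (ZMod M))]
        rw [← sum_neg_distrib]
        refine sum_congr rfl fun v _ => ?_
        rw [Equiv.neg_apply, hψ.eval_neg, lift_neg hM, hodd, mul_neg]
      exact self_eq_neg.mp hT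
    · -- odd characters
      have hf₀M : ψ.conductor ∣ M := ψ.conductor_dvd_level
      have hf₀N : ψ.conductor ∣ N := hf₀M.trans hM
      haveI : NeZero ψ.conductor := ⟨ψ.conductor_ne_zero⟩
      -- T = T'
      have hTT' : ∑ v : ZMod M, ψ v * g ((((N / M : ℕ) : ZMod N) * ((ZMod.val v : ℕ) : ZMod N))) = ∑ v : ZMod M,
          ψ.primitiveCharacter (ZMod.castHom hf₀M (ZMod ψ.conductor) v) * g ((((N / M : ℕ) : ZMod N) * ((ZMod.val v : ℕ) : ZMod N))) := by
        refine sum_congr rfl fun v _ => ?_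
        by_cases hv : IsUnit v
        · congr 1
          have := DirichletCharacter.changeLevel_eq_cast_of_dvd ψ.primitiveCharacter hf₀M hv.unit
          rw [DirichletCharacter.changeLevel_primitiveCharacter, IsUnit.unit_spec] at this
          rw [this, ZMod.castHom_apply]
        · rw [MulChar.map_nonunit _ hv, zero_mul]
          obtain ⟨hdvd, ⟨w', hw', hlift⟩, hlt⟩ := lift_reduce hM v
          rw [← hlift, IH _ (hlt hv) (hdvd.trans hM) w' hw', mul_zero]
      -- T' is the primitive coordinate of `changeLevel ψ`
      have hT' : ∑ x : ZMod N, ψ.primitiveCharacter (ZMod.castHom hf₀N (ZMod ψ.conductor) x) * g x =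
          ∑ v : ZMod M, ψ.primitiveCharacter (ZMod.castHom hf₀M (ZMod ψ.conductor) v) *
            g ((((N / M : ℕ) : ZMod N) * ((ZMod.val v : ℕ) : ZMod N))) := by
        have hcomp : ∀ x : ZMod N, ZMod.castHom hf₀N (ZMod ψ.conductor) x =
            ZMod.castHom hf₀M (ZMod ψ.conductor) (ZMod.castHom hM (ZMod M) x) := fun x => by
          rw [← RingHom.comp_apply, ZMod.castHom_comp]
        simp_rw [hcomp]
        exact sum_eq_sum_level hM g (hdist M hM)
          (fun v => ψ.primitiveCharacter (ZMod.castHom hf₀M (ZMod ψ.conductor) v))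
      have hzero : ∑ x : ZMod N,
          ψ.primitiveCharacter (ZMod.castHom hf₀N (ZMod ψ.conductor) x) * g x = 0 := by
        have h1 := hΦ _ (odd_changeLevel hM hψ)
        have hconv : ∀ x : ZMod N, ((DirichletCharacter.primitiveCharacter (DirichletCharacter.changeLevel hM ψ)) (ZMod.castHom (DirichletCharacter.conductor_dvd_level (DirichletCharacter.changeLevel hM ψ)) (ZMod (DirichletCharacter.conductor (DirichletCharacter.changeLevel hM ψ))) x)) =
            ψ.primitiveCharacter (ZMod.castHom hf₀N (ZMod ψ.conductor) x) := by
          intro x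
          have h2 := DirichletCharacter.primitiveCharacter_changeLevel_apply hM ψ (x.val : ℤ)
          rw [Int.cast_natCast, Int.cast_natCast] at h2
          rw [ZMod.castHom_apply, ZMod.cast_eq_val, h2, ZMod.castHom_apply, ZMod.cast_eq_val]
        simp_rw [hconv] at h1
        exact h1
      rw [hTT', ← hT', hzero]
  -- every `x` is `(N/M)·w` for a unit `w` of some level `M ∣ N`
  obtain ⟨hdvd, ⟨w, hw, hlift⟩, -⟩ := lift_reduce (dvd_refl N) x
  rw [← lift_self x, ← hlift]
  exact main _ (hdvd.trans (dvd_refl N)) w hw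

/-! ### The primitive odd coordinates of the Bernoulli distribution and its unit twists -/

omit [NeZero N] in
/-- `(changeLevel ψ)(-1) = ψ(-1)`: level change preserves parity. [folklore] -/
theorem changeLevel_neg_one {M : ℕ} (hM : M ∣ N) (ψ : DirichletCharacter ℂ M) :
    DirichletCharacter.changeLevel hM ψ (-1) = ψ (-1) := by
  have := DirichletCharacter.changeLevel_eq_cast_of_dvd ψ hM (-1)
  rw [Units.val_neg, Units.val_one] at this
  rw [this, ← ZMod.castHom_apply (h := hM), map_neg, map_one]

omit [NeZero N] in
/-- The primitive character of an odd character is odd. [folklore] -/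
theorem odd_primitiveCharacter {χ : DirichletCharacter ℂ N} (hχ : χ.Odd) :
    χ.primitiveCharacter.Odd := by
  rw [DirichletCharacter.Odd, ← changeLevel_neg_one χ.conductor_dvd_level,
    DirichletCharacter.changeLevel_primitiveCharacter]
  exact hχ

omit [NeZero N] in
/-- `χ₀(u mod f) = χ(u)` for a unit `u` mod `N` (`χ₀` the primitive character of `χ`). [folklore] -/
theorem prim_apply_unit (χ : DirichletCharacter ℂ N) {u : ZMod N} (hu : IsUnit u) :
    ((DirichletCharacter.primitiveCharacter χ) (ZMod.castHom (DirichletCharacter.conductor_dvd_level χ) (ZMod (DirichletCharacter.conductor χ)) u)) = χ u := by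
  have := DirichletCharacter.changeLevel_eq_cast_of_dvd χ.primitiveCharacter
    χ.conductor_dvd_level hu.unit
  rw [DirichletCharacter.changeLevel_primitiveCharacter, IsUnit.unit_spec] at this
  rw [this, ZMod.castHom_apply]

/-- **Twisting by a unit multiplies the coordinate by `χ(u)⁻¹`**:
`∑_x χ₀(x) β(ux) = χ(u)⁻¹ ∑_x χ₀(x) β(x)`. [folklore] -/
theorem prim_sum_bern_unit (χ : DirichletCharacter ℂ N) {u : ZMod N} (hu : IsUnit u) :
    ∑ x : ZMod N, ((DirichletCharacter.primitiveCharacter χ) (ZMod.castHom (DirichletCharacter.conductor_dvd_level χ) (ZMod (DirichletCharacter.conductor χ)) x)) * (if (u * x) = (0 : ZMod N) then (0 : ℂ) else (((ZMod.val (u * x) : ℕ) : ℂ) / (N : ℂ) - 1 / 2)) = (χ u)⁻¹ * ∑ x : ZMod N, ((DirichletCharacter.primitiveCharacter χ) (ZMod.castHom (DirichletCharacter.conductor_dvd_level χ) (ZMod (DirichletCharacter.conductor χ)) x)) * (if x = (0 : ZMod N) then (0 : ℂ) else (((ZMod.val x : ℕ) : ℂ) / (N : ℂ) - 1 / 2))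 := by
  classical
  set v : (ZMod N)ˣ := hu.unit with hv
  have huv : (v : ZMod N) = u := hu.unit_spec
  have hinv : (χ u)⁻¹ = χ (↑v⁻¹ : ZMod N) := by
    rw [← huv]
    refine (eq_inv_of_mul_eq_one_left ?_).symm
    rw [← map_mul, Units.inv_mul, map_one]
  rw [hinv, ← Equiv.sum_comp v⁻¹.mulLeft, Finset.mul_sum]
  refine sum_congr rfl fun x _ => ?_
  have hux : u * (↑v⁻¹ * x) = x := by rw [← huv, Units.mul_inv_cancel_left]
  simp only [Units.mulLeft_apply, hux]
  rw [map_mul, map_mul, prim_apply_unit χ (Units.isUnit v⁻¹)]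
  ring

/-- **The primitive coordinate of `β` is `B_{1,χ₀} = (1/f) ∑_{v mod f} χ₀(v) v`.** [folklore] -/
theorem prim_sum_bern (χ : DirichletCharacter ℂ N) [NeZero χ.conductor] (hχ : χ.Odd) :
    ∑ x : ZMod N, ((DirichletCharacter.primitiveCharacter χ) (ZMod.castHom (DirichletCharacter.conductor_dvd_level χ) (ZMod (DirichletCharacter.conductor χ)) x)) * (if x = (0 : ZMod N) then (0 : ℂ) else (((ZMod.val x : ℕ) : ℂ) / (N : ℂ) - 1 / 2)) =
      (1 / χ.conductor) * ∑ v : ZMod χ.conductor, χ.primitiveCharacter v * (v.val : ℂ) := by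
  classical
  have hf : χ.conductor ∣ N := χ.conductor_dvd_level
  obtain ⟨hf0, hm0, hNf⟩ := div_ne_zero_of_dvd hf
  have hf1 : χ.conductor ≠ 1 := level_ne_one_of_odd (odd_primitiveCharacter hχ)
  have hN : (N : ℂ) ≠ 0 := by exact_mod_cast NeZero.ne N
  have hfC : (χ.conductor : ℂ) ≠ 0 := by exact_mod_cast hf0
  rw [sum_eq_sum_level hf (fun x => (if x = (0 : ZMod N) then (0 : ℂ) else (((ZMod.val x : ℕ) : ℂ) / (N : ℂ) - 1 / 2))) (fun y => bern_dist hf y) χ.primitiveCharacter]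
  -- the value of `β` at `(N/f)·v`
  have hval : ∀ v : ZMod χ.conductor,
      (if ((((N / χ.conductor : ℕ) : ZMod N) * ((ZMod.val v : ℕ) : ZMod N))) = (0 : ZMod N) then (0 : ℂ) else (((ZMod.val ((((N / χ.conductor : ℕ) : ZMod N) * ((ZMod.val v : ℕ) : ZMod N))) : ℕ) : ℂ) / (N : ℂ) - 1 / 2)) = if v = 0 then 0 else ((v.val : ℂ) / χ.conductor - 1 / 2) := by
    intro v
    have hvv : (((v.val : ℕ) : ZMod N)).val = v.val :=
      ZMod.val_natCast_of_lt ((ZMod.val_lt v).trans_le (Nat.le_of_dvd (NeZero.pos N) hf))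
    have h1 : ((((N / χ.conductor : ℕ) : ZMod N) * ((ZMod.val v : ℕ) : ZMod N))).val = N / χ.conductor * v.val := by
      rw [val_div_mul hf, hvv, Nat.mod_eq_of_lt (ZMod.val_lt v)]
    by_cases hv0 : v = 0
    · simp [hv0]
    · have hne : (((N / χ.conductor : ℕ) : ZMod N) * ((ZMod.val v : ℕ) : ZMod N)) ≠ 0 := by
        rw [Ne, ← ZMod.val_eq_zero, h1]
        exact Nat.mul_ne_zero hm0 ((ZMod.val_ne_zero v).mpr hv0)
      rw [if_neg hne, if_neg hv0, h1]
      congr 1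
      have : (N : ℂ) = χ.conductor * (N / χ.conductor : ℕ) := by exact_mod_cast hNf
      rw [this]
      push_cast
      field_simp
  simp_rw [hval]
  have hsum : ∑ v : ZMod χ.conductor, χ.primitiveCharacter v = 0 :=
    χ.primitiveCharacter.sum_eq_zero_of_ne_one (ne_one_of_odd (odd_primitiveCharacter hχ))
  have : ∀ v : ZMod χ.conductor,
      χ.primitiveCharacter v * (if v = 0 then 0 else ((v.val : ℂ) / χ.conductor - 1 / 2)) =
      (1 / χ.conductor) * (χ.primitiveCharacter v * (v.val : ℂ)) - (1 / 2) * χ.primitiveCharacter v := by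
    intro v
    by_cases hv0 : v = 0
    · rw [hv0, χ.primitiveCharacter.map_zero' hf1]; simp
    · rw [if_neg hv0]; ring
  rw [sum_congr rfl fun v _ => this v, sum_sub_distrib, ← mul_sum, ← mul_sum, hsum, mul_zero,
    sub_zero]

/-- **Non-vanishing of the primitive odd coordinates of `β`** (the arithmetic input
`B_{1,χ₀} ≠ 0`, `GammaMonomialsLValue.sum_char_mul_val_ne_zero`). [folklore] -/
theorem prim_sum_bern_ne_zero (χ : DirichletCharacter ℂ N) (hχ : χ.Odd) :
    ∑ x : ZMod N, ((DirichletCharacter.primitiveCharacter χ) (ZMod.castHom (DirichletCharacter.conductor_dvd_level χ) (ZMod (DirichletCharacter.conductor χ)) x)) * (if x = (0 : ZMod N) then (0 : ℂ) else (((ZMod.val x : ℕ) : ℂ) / (N : ℂ) - 1 / 2)) ≠ 0 := by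
  haveI : NeZero χ.conductor := ⟨χ.conductor_ne_zero⟩
  rw [prim_sum_bern χ hχ]
  refine mul_ne_zero (one_div_ne_zero (by exact_mod_cast χ.conductor_ne_zero)) ?_
  exact sum_char_mul_val_ne_zero (odd_primitiveCharacter hχ) χ.primitiveCharacter_isPrimitive

/-! ### Character orthogonality in the form needed -/

open Classical in
/-- `∑_{u mod N} ψ(u) χ(u)⁻¹ = [ψ = χ] φ(N)`. [folklore] -/
theorem sum_char_mul_inv (ψ χ : DirichletCharacter ℂ N) :
    ∑ u : ZMod N, ψ u * (χ u)⁻¹ = if ψ = χ then (N.totient : ℂ) else 0 := by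
  classical
  have : ∀ u : ZMod N, ψ u * (χ u)⁻¹ = (ψ * χ⁻¹) u := fun u => by
    rw [MulChar.mul_apply, MulChar.inv_apply_eq_inv']
  simp_rw [this]
  by_cases h : ψ = χ
  · subst h
    rw [mul_inv_cancel, MulChar.sum_one_eq_card_units, ZMod.card_units_eq_totient, if_pos rfl]
  · rw [if_neg h]
    exact MulChar.sum_eq_zero_of_ne_one (fun h1 => h (mul_inv_eq_one.mp h1))

/-! ### Every odd distribution is a combination of unit twists of `β` -/

/-- **Kubert–Lang / Koblitz–Ogus spanning theorem.** Every odd distribution `g : ℤ/N → ℂ` (odd,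
satisfying the distribution relations for all `M ∣ N`) is a `ℂ`-linear combination of the unit
twists `x ↦ β(ux)` of the Bernoulli distribution, with coefficients supported on the units:
`c(u) = φ(N)⁻¹ ∑_{χ odd} (Φ_χ[g]/Φ_χ[β]) χ(u)`, where `Φ_χ[h] = ∑_x χ₀(x) h(x)`; the difference
`g - ∑ c(u) β(u·)` is an odd distribution all of whose primitive odd coordinates vanish, hence is
zero by `oddDist_eq_zero`. [cite: Lang1990, Ch. 2 §8–§10] -/
theorem oddDist_eq_sum_bern (g : ZMod N → ℂ) (hodd : ∀ x, g (-x) = -g x)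
    (hdist : ∀ M : ℕ, ∀ hM : M ∣ N, ∀ y : ZMod N,
      ∑ x ∈ (Finset.univ.filter (fun x' : ZMod N => ZMod.val x' % M = ZMod.val y % M)), g x = g (((N / M : ℕ) : ZMod N) * y)) :
    ∃ c : ZMod N → ℂ, (∀ u, ¬IsUnit u → c u = 0) ∧
      ∀ x, g x = ∑ u : ZMod N, c u * (if (u * x) = (0 : ZMod N) then (0 : ℂ) else (((ZMod.val (u * x) : ℕ) : ℂ) / (N : ℂ) - 1 / 2)) := by
  classical
  -- the target values and the coefficients
  set T : DirichletCharacter ℂ N → ℂ := fun χ =>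
    if χ.Odd then (∑ x : ZMod N, ((DirichletCharacter.primitiveCharacter χ) (ZMod.castHom (DirichletCharacter.conductor_dvd_level χ) (ZMod (DirichletCharacter.conductor χ)) x)) * g x) / (∑ x : ZMod N, ((DirichletCharacter.primitiveCharacter χ) (ZMod.castHom (DirichletCharacter.conductor_dvd_level χ) (ZMod (DirichletCharacter.conductor χ)) x)) * (if x = (0 : ZMod N) then (0 : ℂ) else (((ZMod.val x : ℕ) : ℂ) / (N : ℂ) - 1 / 2))) else 0
    with hT
  set c : ZMod N → ℂ := fun u => (N.totient : ℂ)⁻¹ * ∑ χ : DirichletCharacter ℂ N, T χ * χ u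
    with hc
  have hcu : ∀ u, ¬IsUnit u → c u = 0 := by
    intro u hu
    simp only [hc, MulChar.map_nonunit _ hu, mul_zero, sum_const_zero]
  refine ⟨c, hcu, ?_⟩
  -- the difference `g' = g - ∑ c(u) β(u·)`
  set g' : ZMod N → ℂ := fun x => g x - ∑ u : ZMod N, c u * (if (u * x) = (0 : ZMod N) then (0 : ℂ) else (((ZMod.val (u * x) : ℕ) : ℂ) / (N : ℂ) - 1 / 2)) with hg'
  clear_value g' c T
  suffices h : ∀ x, g' x = 0 by
    intro x
    have := h x
    rw [hg'] at this
    exact sub_eq_zero.mp this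
  refine oddDist_eq_zero g' ?_ ?_ ?_
  · -- oddness
    intro x
    simp only [hg', hodd, mul_neg, bern_neg, Finset.sum_neg_distrib]
    ring
  · -- distribution relations
    intro M hM y
    simp only [hg', sum_sub_distrib, hdist M hM y]
    congr 1
    rw [Finset.sum_comm]
    refine sum_congr rfl fun u _ => ?_
    rw [← mul_sum]
    by_cases hu : IsUnit u
    · rw [bern_unit_dist hM hu y]
    · rw [hcu u hu, zero_mul, zero_mul]
  · -- the primitive odd coordinates vanish
    intro χ hχ
    have hβ := prim_sum_bern_ne_zero χ hχ
    have hφ : (N.totient : ℂ) ≠ 0 := by exact_mod_cast (Nat.totient_pos.mpr (NeZero.pos N)).ne'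
    -- expand
    have hexp : ∑ x : ZMod N, ((DirichletCharacter.primitiveCharacter χ) (ZMod.castHom (DirichletCharacter.conductor_dvd_level χ) (ZMod (DirichletCharacter.conductor χ)) x)) * g' x = ∑ x : ZMod N, ((DirichletCharacter.primitiveCharacter χ) (ZMod.castHom (DirichletCharacter.conductor_dvd_level χ) (ZMod (DirichletCharacter.conductor χ)) x)) * g x -
        ∑ u : ZMod N, c u * ∑ x : ZMod N, ((DirichletCharacter.primitiveCharacter χ) (ZMod.castHom (DirichletCharacter.conductor_dvd_level χ) (ZMod (DirichletCharacter.conductor χ)) x)) * (if (u * x) = (0 : ZMod N) then (0 : ℂ) else (((ZMod.val (u * x) : ℕ) : ℂ) / (N : ℂ) - 1 / 2)) := by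
      simp only [hg', mul_sub, sum_sub_distrib, Finset.mul_sum]
      congr 1
      rw [Finset.sum_comm]
      refine sum_congr rfl fun u _ => sum_congr rfl fun x _ => ?_
      ring
    have htwist : ∑ u : ZMod N, c u * ∑ x : ZMod N, ((DirichletCharacter.primitiveCharacter χ) (ZMod.castHom (DirichletCharacter.conductor_dvd_level χ) (ZMod (DirichletCharacter.conductor χ)) x)) * (if (u * x) = (0 : ZMod N) then (0 : ℂ) else (((ZMod.val (u * x) : ℕ) : ℂ) / (N : ℂ) - 1 / 2)) =
        (∑ u : ZMod N, c u * (χ u)⁻¹) * ∑ x : ZMod N, ((DirichletCharacter.primitiveCharacter χ) (ZMod.castHom (DirichletCharacter.conductor_dvd_level χ) (ZMod (DirichletCharacter.conductor χ)) x)) * (if x = (0 : ZMod N) then (0 : ℂ) else (((ZMod.val x : ℕ) : ℂ) / (N : ℂ) - 1 / 2)) := by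
      rw [sum_mul]
      refine sum_congr rfl fun u _ => ?_
      by_cases hu : IsUnit u
      · rw [prim_sum_bern_unit χ hu]
        ring
      · rw [hcu u hu, zero_mul, zero_mul, zero_mul]
    have hcoef : ∑ u : ZMod N, c u * (χ u)⁻¹ = T χ := by
      have hcu' : ∀ u : ZMod N, c u * (χ u)⁻¹ = (N.totient : ℂ)⁻¹ *
          ∑ ψ : DirichletCharacter ℂ N, T ψ * (ψ u * (χ u)⁻¹) := by
        intro u
        simp only [hc]
        rw [Finset.mul_sum, Finset.sum_mul, Finset.mul_sum]
        refine sum_congr rfl fun ψ _ => ?_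
        ring
      rw [sum_congr rfl fun u _ => hcu' u, ← Finset.mul_sum, Finset.sum_comm]
      simp_rw [← Finset.mul_sum, sum_char_mul_inv]
      simp only [mul_ite, mul_zero, Finset.sum_ite_eq', Finset.mem_univ, if_true]
      rw [mul_comm (T χ), ← mul_assoc, inv_mul_cancel₀ hφ, one_mul]
    rw [hexp, htwist, hcoef, hT]
    simp only [if_pos hχ]
    rw [div_mul_cancel₀ _ hβ, sub_self]

/-! ### Hodge type over `ℚ`: membership in the span of the relation vectors -/

omit [NeZero N] in
/-- Compatibility of the two casts of `β`. [folklore] -/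
theorem bern_cast (y : ZMod N) : (((if y = (0 : ZMod N) then (0 : ℚ) else (((ZMod.val y : ℕ) : ℚ) / (N : ℚ) - 1 / 2)) : ℚ) : ℂ) = (if y = (0 : ZMod N) then (0 : ℂ) else (((ZMod.val y : ℕ) : ℂ) / (N : ℂ) - 1 / 2)) := by
  split_ifs <;> push_cast <;> ring

/-- **Koblitz–Ogus, linear-algebra form.** Let `f : ℤ/N → ℚ` satisfy the Hodge-type condition
`∑_x f(x) β(ux) = 0` for every unit `u`. Then `f` is a `ℚ`-linear combination of the REFLECTION
vectors `e_a + e_{-a}` (`a ∈ ℤ/N`) and the DISTRIBUTION vectors `∑_{x ≡ y (M)} e_x - e_{(N/M)y}`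
(`M ∣ N`, `y ∈ ℤ/N`). Proof: by the double annihilator it suffices that every functional `φ`
killing these vectors kills `f`; `x ↦ φ(e_x)` is then an odd distribution, hence (over `ℂ`) a
combination `∑ c(u) β(u·)` supported on units (`oddDist_eq_sum_bern`), and
`φ(f) = ∑_x f(x) φ(e_x) = ∑_u c(u) ∑_x f(x) β(ux) = 0`.
[cite: Deligne1982HodgeCycles, Rem. 7.16 (a)] -/
theorem hodge_eq_combination (f : ZMod N → ℚ)
    (hf : ∀ u : ZMod N, IsUnit u → ∑ x : ZMod N, f x * (if (u * x) = (0 : ZMod N) then (0 : ℚ) else (((ZMod.val (u * x) : ℕ) : ℚ) / (N : ℚ) - 1 / 2)) = 0) :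
    ∃ (cr : ZMod N → ℚ) (cd : ℕ → ZMod N → ℚ), ∀ x : ZMod N, f x =
      ∑ a : ZMod N, cr a * ((if a = x then 1 else 0) + (if -a = x then 1 else 0)) +
      ∑ M ∈ N.divisors, ∑ y : ZMod N, cd M y *
        ((if x.val % M = y.val % M then 1 else 0) - (if ((N / M : ℕ) : ZMod N) * y = x then 1 else 0)) := by
  classical
  -- the relation vectors
  set rel : (ZMod N) ⊕ (N.divisors × ZMod N) → (ZMod N → ℚ) := Sum.elim
    (fun a x => (if a = x then 1 else 0) + (if -a = x then 1 else 0))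
    (fun p x => (if x.val % (p.1 : ℕ) = p.2.val % (p.1 : ℕ) then 1 else 0) -
      (if ((N / (p.1 : ℕ) : ℕ) : ZMod N) * p.2 = x then 1 else 0)) with hrel
  set W : Submodule ℚ (ZMod N → ℚ) := Submodule.span ℚ (Set.range rel) with hW
  -- Step 1: `f ∈ W` by the double annihilator
  have hmem : f ∈ W := by
    rw [← Subspace.dualAnnihilator_dualCoannihilator_eq (W := W), Submodule.mem_dualCoannihilator]
    intro φ hφ
    rw [Submodule.mem_dualAnnihilator] at hφ
    -- the vector of values of `φ` on the coordinate vectors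
    set gq : ZMod N → ℚ := fun i => φ (fun j => if i = j then 1 else 0) with hgq
    have hφf : φ f = ∑ i : ZMod N, f i * gq i := by
      conv_lhs => rw [pi_eq_sum_univ f]
      rw [map_sum]
      refine sum_congr rfl fun i _ => ?_
      rw [map_smul, smul_eq_mul]
    have hrelW : ∀ i, φ (rel i) = 0 := fun i => hφ _ (Submodule.subset_span ⟨i, rfl⟩)
    -- oddness of `gq`
    have hodd : ∀ a : ZMod N, gq (-a) = -gq a := by
      intro a
      have h := hrelW (Sum.inl a)
      have : rel (Sum.inl a) = (fun j => if a = j then (1 : ℚ) else 0) + fun j => if -a = j then 1 else 0 := by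
        funext j; simp [hrel]
      rw [this, map_add] at h
      exact eq_neg_of_add_eq_zero_right h
    -- distribution relations of `gq`
    have hdistq : ∀ M : ℕ, M ∣ N → ∀ y : ZMod N,
        ∑ x ∈ (Finset.univ.filter (fun x' : ZMod N => ZMod.val x' % M = ZMod.val y % M)), gq x = gq (((N / M : ℕ) : ZMod N) * y) := by
      intro M hM y
      have hMd : M ∈ N.divisors := Nat.mem_divisors.mpr ⟨hM, NeZero.ne N⟩
      have h := hrelW (Sum.inr (⟨M, hMd⟩, y))
      have : rel (Sum.inr (⟨M, hMd⟩, y)) =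
          (∑ x ∈ (Finset.univ.filter (fun x' : ZMod N => ZMod.val x' % M = ZMod.val y % M)), fun j => if x = j then (1 : ℚ) else 0) -
            fun j => if ((N / M : ℕ) : ZMod N) * y = j then 1 else 0 := by
        funext j
        simp only [hrel, Sum.elim_inr, Pi.sub_apply, Finset.sum_apply]
        congr 1
        rw [Finset.sum_ite_eq' ((Finset.univ.filter (fun x' : ZMod N => ZMod.val x' % M = ZMod.val y % M))) j (fun _ => (1 : ℚ))]
        simp only [mem_filter, mem_univ, true_and]
      rw [this, map_sub, map_sum] at h
      exact sub_eq_zero.mp h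
    -- pass to `ℂ` and apply the spanning theorem
    obtain ⟨c, hcu, hrep⟩ := oddDist_eq_sum_bern (fun x => (gq x : ℂ))
      (fun x => by simp only [hodd, Rat.cast_neg])
      (fun M hM y => by
        have := congrArg (Rat.cast (K := ℂ)) (hdistq M hM y)
        push_cast at this
        exact this)
    have hφC : ((φ f : ℚ) : ℂ) = 0 := by
      rw [hφf]
      push_cast
      simp_rw [hrep, Finset.mul_sum]
      rw [Finset.sum_comm]
      refine sum_eq_zero fun u _ => ?_
      by_cases hu : IsUnit u
      · have h0 := congrArg (Rat.cast (K := ℂ)) (hf u hu)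
        push_cast [bern_cast] at h0
        calc ∑ x : ZMod N, (f x : ℂ) * (c u * (if (u * x) = (0 : ZMod N) then (0 : ℂ) else (((ZMod.val (u * x) : ℕ) : ℂ) / (N : ℂ) - 1 / 2)))
            = c u * ∑ x : ZMod N, (f x : ℂ) * (if (u * x) = (0 : ZMod N) then (0 : ℂ) else (((ZMod.val (u * x) : ℕ) : ℂ) / (N : ℂ) - 1 / 2)) := by
              rw [Finset.mul_sum]; exact sum_congr rfl fun x _ => by ring
          _ = 0 := by rw [h0, mul_zero]
      · simp [hcu u hu]
    exact_mod_cast hφC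
  -- Step 2: unpack the coefficients
  obtain ⟨cι, hcι⟩ := (Submodule.mem_span_range_iff_exists_fun ℚ).mp hmem
  refine ⟨fun a => cι (Sum.inl a), fun M y => if h : M ∈ N.divisors then cι (Sum.inr (⟨M, h⟩, y)) else 0,
    fun x => ?_⟩
  have hx := congrFun hcι x
  rw [Finset.sum_apply, Fintype.sum_sum_type] at hx
  rw [← hx]
  -- the reflection part agrees definitionally; it remains to re-index the distribution part
  congr 1
  rw [Fintype.sum_prod_type, ← Finset.sum_coe_sort N.divisors]
  refine sum_congr rfl fun M _ => sum_congr rfl fun y _ => ?_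
  simp only [hrel, Pi.smul_apply, Sum.elim_inr, smul_eq_mul, dif_pos M.2]

/-! ### Clearing denominators: the integral relation -/

/-- If `q.den ∣ n` then `n q` is the integer `(n / q.den) q.num`. [folklore] -/
theorem cast_div_den_mul_num {q : ℚ} {n : ℕ} (h : q.den ∣ n) :
    ((((n / q.den : ℕ) : ℤ) * q.num : ℤ) : ℚ) = n * q := by
  have hd : (q.den : ℚ) ≠ 0 := by exact_mod_cast q.den_ne_zero
  rw [Int.cast_mul, Int.cast_natCast, Nat.cast_div h hd, ← Rat.mul_den_eq_num q]
  field_simp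

/-- **Koblitz–Ogus, integral form.** If `f : ℤ/N → ℤ` is of Hodge type (`∑_x f(x) β(ux) = 0` for all
units `u`), then some positive multiple `n₀ f` is an INTEGRAL combination of the reflection vectors
`e_a + e_{-a}` and the distribution vectors `∑_{x ≡ y (M)} e_x - e_{(N/M)y}` (`M ∣ N`).
[cite: Deligne1982HodgeCycles, Rem. 7.16 (a)] -/
theorem hodge_eq_combination_int (f : ZMod N → ℤ)
    (hf : ∀ u : ZMod N, IsUnit u → ∑ x : ZMod N, (f x : ℚ) * (if (u * x) = (0 : ZMod N) then (0 : ℚ) else (((ZMod.val (u * x) : ℕ) : ℚ) / (N : ℚ) - 1 / 2)) = 0) :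
    ∃ n₀ : ℕ, 0 < n₀ ∧ ∃ (mr : ZMod N → ℤ) (md : ℕ → ZMod N → ℤ), ∀ x : ZMod N,
      (n₀ : ℤ) * f x =
      ∑ a : ZMod N, mr a * ((if a = x then 1 else 0) + (if -a = x then 1 else 0)) +
      ∑ M ∈ N.divisors, ∑ y : ZMod N, md M y *
        ((if x.val % M = y.val % M then 1 else 0) - (if ((N / M : ℕ) : ZMod N) * y = x then 1 else 0)) := by
  classical
  obtain ⟨cr, cd, hc⟩ := hodge_eq_combination (fun x => (f x : ℚ)) hf
  -- a common denominator
  set n₀ : ℕ := (∏ a : ZMod N, (cr a).den) * ∏ M ∈ N.divisors, ∏ y : ZMod N, (cd M y).den with hn₀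
  have hn₀pos : 0 < n₀ := by
    refine Nat.mul_pos (Finset.prod_pos fun a _ => (cr a).den_pos) ?_
    exact Finset.prod_pos fun M _ => Finset.prod_pos fun y _ => (cd M y).den_pos
  have hdr : ∀ a, (cr a).den ∣ n₀ := fun a =>
    dvd_mul_of_dvd_left (Finset.dvd_prod_of_mem (fun a => (cr a).den) (mem_univ a)) _
  have hdd : ∀ M ∈ N.divisors, ∀ y, (cd M y).den ∣ n₀ := fun M hM y =>
    dvd_mul_of_dvd_right ((Finset.dvd_prod_of_mem (fun y => (cd M y).den) (mem_univ y)).trans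
      (Finset.dvd_prod_of_mem (fun M => ∏ y : ZMod N, (cd M y).den) hM)) _
  refine ⟨n₀, hn₀pos, fun a => ((n₀ / (cr a).den : ℕ) : ℤ) * (cr a).num,
    fun M y => ((n₀ / (cd M y).den : ℕ) : ℤ) * (cd M y).num, fun x => ?_⟩
  have hmr : ∀ a, ((((n₀ / (cr a).den : ℕ) : ℤ) * (cr a).num : ℤ) : ℚ) = n₀ * cr a := fun a =>
    cast_div_den_mul_num (hdr a)
  have hmd : ∀ M ∈ N.divisors, ∀ y,
      ((((n₀ / (cd M y).den : ℕ) : ℤ) * (cd M y).num : ℤ) : ℚ) = n₀ * cd M y := fun M hM y =>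
    cast_div_den_mul_num (hdd M hM y)
  apply Int.cast_injective (α := ℚ)
  have hx := hc x
  rw [Int.cast_mul, Int.cast_natCast, hx, mul_add, Finset.mul_sum, Finset.mul_sum, Int.cast_add,
    Int.cast_sum, Int.cast_sum]
  congr 1
  · refine sum_congr rfl fun a _ => ?_
    rw [Int.cast_mul, hmr a]
    push_cast
    ring
  · refine sum_congr rfl fun M hM => ?_
    rw [Finset.mul_sum, Int.cast_sum]
    refine sum_congr rfl fun y _ => ?_
    rw [Int.cast_mul, hmd M hM y]
    push_cast
    ring

end KoblitzOgus

end Literature.NumberTheory.Transcendental
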